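import Summits.QuantumFields.BalabanUV.Beta.FP.NestedStepLawTorusTransported
import Summits.QuantumFields.BalabanUV.Beta.FP.NestedStepLawTorusInstanceRows
import Summits.QuantumFields.BalabanUV.Beta.FP.PeriodisedCompositeIndexWard

/-!
# `BalabanUV.Beta.FP.NestedStepLawTorusTransportedRows` — road «FP» for binder row D1, ROUTE T, (T-INST-j) in presentation T-β: **THE OWNER's TORUS CALL,
# TRANSPORT FIRST (`NestedStepLawTorusTransported`, (B)) WITH leaf-02's ROWS DISCHARGED BY TERM** — order 0 `a0 a0t` (`Y₀ = Y'₀ := 0`;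
# `PeriodisedWardOrderZero`), order 1 `c1` (p314580), `d1` (`PeriodisedCoarseWardContact`), the nested dead-row letter `t1` (`NestedStepLawTorusInstanceRows`
# v1.2, under «the direction's average is coarse-comb dead») and the (T-β-1) composite letter `q1` (`PeriodisedCompositeIndexWard.torus_q1_letter`) — the
# transport generators `X X̄` PINNED to the diagonal gauge generators of a parameter `λ`

WHAT.  The OWNER d1-p3 g18's (B) `NestedStepLawTorusTransported.secondVar_oneShot_nestedStepLaw_torus_transported` is the δ-constrained torus call with
the chart transport inserted first (exponential currency `A = (1, X, X·X)`, `Ā = (1, X̄, X̄·X̄)`, parameter transport `C = (1, C₁, C₂)`): ZERO Faddeev–Popov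
defect in the conclusion, the one-shot literal's jets NAMED by `k1 k2 q1 q2`, the intertwining `j1 j2 uC`, six dead rows `p1 p2 s1 s2 t1 t2`, and p308750's
table rows `a* c* d*`.  This file is that theorem with leaf-02's rows SUPPLIED, exactly as `NestedStepLawTorusInstanceRows` (p318378) did for the Delta:

* the direction `h` on the fine torus bonds and the GAUGE PARAMETER `λ : pbox (fine Lc M′) → ℝ` of the chart transport are data; the insertion-table
  FAMILIES `Q₁₁ w` (fine, an1's rooted `vhSAt` periodised) and `Q₂₁ w` (coarse, transported by `θ_j·Q₁₀`, `θ_j = stepScale_{j+1} ∕ (stepScale_j²·#B)`),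
  the generator jet `W₁` and the coarse jet `D̄₁` along `h` are bound by their defining equations (`hQ₁₁ hQ₂₁ hW₁ hDb₁`, the shapes of p314580 ∕ p317562 ∕
  p318378 VERBATIM); the composite jets are NAMED along `h` (`h𝔔₁ : Q₂₁ h * Q₁₀ + Q₂₀ * Q₁₁ h = 𝔔₁`, `h𝔔₂`);
* (T-β-1) AT THE TORUS: the transport generators are PINNED by defining equations to the DIAGONAL gauge generators of `λ` — fields
  `hX : X = −(c • diagonal (λ ∘ base))`, composite multipliers `hXbar : X̄ = c • diagonal (λ̄ at the composite multiplier's base block root)`,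
  `c = (Lc^{d+1}·stepScale_j)⁻¹`, `λ̄ t̄ = Σ_s tdelta (fine Lc M′) (Lc•t̄ + toSite r) s · λ s` — and the one-shot literal's first composite averaging jet is
  NAMED as the composite insertion jet ALONG THE GAUGE-SHIFTED DIRECTION `h + Dλ` (`h𝔔'₁`); then **`q1 : X̄ * 𝔔₀ + 𝔔₁ + 𝔔₀ * X = 𝔔'₁` is
  `PeriodisedCompositeIndexWard.torus_q1_letter`** (p320102) — DISCHARGED;
* `t1 : τ₂ * (Q₁₁ h * [D₂|D₁] + Q₁₀ * W₁) = 0` is `NestedStepLawTorusInstanceRows.torus_t1_of_average_dead` (p319828) under the displayed hypothesis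
  `hdead` («`Σ_b Q₁₀ a b · h b = 0` at every coarse comb bond `a`» — the nested chart's direction is average-coarse-comb dead) — DISCHARGED;
* `a0 a0t` (`torus_a0_letter ∕ torus_a0t_letter`, p317178, `Y₀ = Y'₀ := 0`; `a1 a2 a1t a2t` in their `Y₀ = 0` shapes), `c1` (`torus_c1_vhSAt_weighted`,
  p314580), `d1` (`torus_d1_vhSAt_weighted`, p317562) — DISCHARGED as in p318378.

What STAYS displayed: the form-block words `k1 k2` (an1 ∕ leaf-05), `q2` (order 2 of (T-β-1): needs the two-insertion index law), the intertwining
`j1 j2 uC` (leaf-06 g18 `TorusGeneratorIntertwining`, INTENT 4), the dead rows `p1 p2 s1 s2 t2` (leaf-06 `NestedStepLawTransportedDeadRows` p319750 gives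
them from vanishing hypotheses), the order-1∕2 Ward rows `a1 a2 a1t a2t` and order-2 covariance rows `c2 d2`, the block namings.  ONE theorem,
**`secondVar_oneShot_nestedStepLaw_torus_transported_rows`**: four `subst`s, one `have` (q1), one `exact`.  [folklore] composition BY NAME; no `def`,
no `def … : Prop`, nothing cited, 0 sorry; every discharged row is a kernel theorem of the tree over OUR typed objects.  Whether the literal's chart
transport IS the diagonal `λ`-multiplication (and which `λ`: the difference of the two charts' tree-gauge functions) is the dictionary's ∕ OWNER's word,
not claimed here.

HONEST DEPENDENCY (page 1, mandatory): continuum YM on T⁴ ⇐ BetaPertH ∧ nine spine estimates (0/9 proved); BetaPertH ⇐ (D1) ∧ (D4) ∧ CAP+tail;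
G-an2-4 gates asym, D1 and NE2/3/4.  HONEST FRAMING (cell contract, verbatim): «discharging `BetaPertH` makes Bałaban's UV stability UNCONDITIONAL —
a real constructive-QFT result; it is NOT the continuum limit and NOT the Clay problem.»  ABSOLUTE RULE (cell charter, verbatim): «No internally-minted
statement may enter as a cited fact. Every hypothesis is either kernel-proved in this package or a verbatim quotation of a PUBLISHED theorem with page
reference. The manuscript(s) under audit are NOT citable for their own disputed steps — they are the thing under adjudication; programme-internal
(2001/route/tribunal) claims are never citable.»  0∕4 row-D1 binders; NOT (T-ID) complete, NOT SDF, NOT D1, NOT BetaPertH, NOT continuum, NOT Clay.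
Road «FP», D1 formalisation swarm leaf-02 (b2b-balaban-beta-d1-formalise-leaf-02) gen 18, 2026-08-22 (OWNER d1-p3 g18 W-5∕I-FP-18-2 «a
`…TorusTransportedRows` twin is leaf-02's for the taking»).  No existing file touched.
-/

noncomputable section

open scoped BigOperators Matrix

namespace Summit.QuantumFields.BalabanUV.Beta.FP.NestedStepLawTorusTransportedRows

open Matrix Finset
open Literature.Probability.LatticeModels (Torus.proj)
open Literature.MathematicalPhysics.QuantumFieldTheory.Balaban1983to89
open Literature.MathematicalPhysics.QuantumFieldTheory.Balaban1983to89.Beta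
open Literature.MathematicalPhysics.QuantumFieldTheory.Balaban1983to89.Beta.Composition (kkt)
open Literature.MathematicalPhysics.QuantumFieldTheory.Balaban1983to89.Beta.CompositionSingular (effForm flucCov minOp minOpL)
open Literature.MathematicalPhysics.QuantumFieldTheory.LatticeForm (quo)
open B5Prop11Plancherel (fine)
open B6Lemma24Torus (pbox mem_pbox)
open AffineAveraging (Site box toSite unitVec)
open AveragingHessianKernelsRooted (vhSAt)
open OneStepResolventKernel (Fib)
open Summit.QuantumFields.BalabanUV.Beta.BorderedHessian (bhKStepAt stepScale)
open Summit.QuantumFields.BalabanUV.Beta.D1BFx.LogDetSecondVariation (secondVar)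
open Summit.QuantumFields.BalabanUV.Beta.FP.KernelPeriodisationFib (Idx perF)
open Summit.QuantumFields.BalabanUV.Beta.FP.KernelPeriodisationFibLoc (dper)
open Summit.QuantumFields.BalabanUV.Beta.FP.TorusGaugeCovariance (tdelta tgrad)
open Summit.QuantumFields.BalabanUV.Beta.FP.TorusGaugeCovarianceCoarse (coarsePt tgradBlock)
open Summit.QuantumFields.BalabanUV.Beta.FP.TorusCombRows (Res combRowsT combBondT)
open Summit.QuantumFields.BalabanUV.Beta.FP.TorusCombNestedBasis (resBigEquiv)
open Summit.QuantumFields.BalabanUV.Beta.GAN24.FineReadoutCauchyFrame (toSite_mem_range)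
open Summit.QuantumFields.BalabanUV.Beta.FP.NestedStepLawTorusTransported (secondVar_oneShot_nestedStepLaw_torus_transported)
open Summit.QuantumFields.BalabanUV.Beta.FP.PeriodisedWardOrderZero (torus_a0_letter torus_a0t_letter)
open Summit.QuantumFields.BalabanUV.Beta.FP.PeriodisedBorderWardContactInstance (torus_c1_vhSAt_weighted)
open Summit.QuantumFields.BalabanUV.Beta.FP.PeriodisedCoarseWardContact (torus_d1_vhSAt_weighted)
open Summit.QuantumFields.BalabanUV.Beta.FP.NestedStepLawTorusInstanceRows (torus_t1_of_average_dead)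
open Summit.QuantumFields.BalabanUV.Beta.FP.PeriodisedCompositeIndexWard (torus_q1_letter)

variable {d : ℕ} (M' : Fin (d + 1) → ℕ) [∀ μ, NeZero (M' μ)] {Lc : ℕ} [NeZero Lc] {r r' : Fin (d + 1) → ℕ}

set_option synthInstance.maxSize 1024 in
/-- [folklore] **THE TORUS CALL, TRANSPORT FIRST (T-β), WITH leaf-02's ROWS DISCHARGED BY TERM.**  The OWNER's (B)
`NestedStepLawTorusTransported.secondVar_oneShot_nestedStepLaw_torus_transported` with: the insertion tables, generator jet and coarse jet bound by defining
equations along a direction `h`; the transport generators `X X̄` PINNED to the diagonal gauge generators of a parameter `λ` (`hX hXbar`); the one-shot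
literal's first composite averaging jet NAMED along the gauge-shifted direction `h + Dλ` (`h𝔔'₁`); and the rows `a0 a0t c1 d1 t1 q1` REMOVED — supplied inside
by `torus_a0_letter`, `torus_a0t_letter` (p317178), `torus_c1_vhSAt_weighted` (p314580), `torus_d1_vhSAt_weighted` (p317562), `torus_t1_of_average_dead`
(p319828, hypothesis `hdead` displayed) and `torus_q1_letter` (p320102).  Conclusion VERBATIM (B)'s: one-shot literal's sliced 2-jet `=` fine one-step sliced
`+` coarse sliced, NO defect. -/
theorem secondVar_oneShot_nestedStepLaw_torus_transported_rows (hr : r ∈ box (d + 1) Lc) (hr' : r' ∈ box (d + 1) Lc) (hM' : ∀ i, Lc ∣ M' i) (j : ℕ)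
    {κ : Type*} [Fintype κ] [DecidableEq κ] (pμ' : κ → ↥(pbox M')) (mμ' : κ → Fin (d + 1))
    (hfμ' : Function.Injective (fun a : κ => ((pμ' a, Sum.inr (mμ' a)) : Idx M' (Fib d))))
    (hcoarse' : ∀ (s : ↥(pbox M')) (m : Fin (d + 1)),
      ((s, Sum.inr m) : Idx M' (Fib d)) ∈ Set.range (fun a : κ => ((pμ' a, Sum.inr (mμ' a)) : Idx M' (Fib d))) ↔ Torus.proj Lc (s : Site (d + 1)) = 0)
    -- the torus objects of record, by defining equations
    {H₀ : Matrix (↥(pbox (fine Lc M')) × Fin (d + 1)) (↥(pbox (fine Lc M')) × Fin (d + 1)) ℝ}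
    {Q₁₀ : Matrix (↥(pbox M') × Fin (d + 1)) (↥(pbox (fine Lc M')) × Fin (d + 1)) ℝ}
    {τ₁ : Matrix (Res (toSite r) Lc (fine Lc M')) (↥(pbox (fine Lc M')) × Fin (d + 1)) ℝ}
    {τ₂ : Matrix (Res (toSite r') Lc M') (↥(pbox M') × Fin (d + 1)) ℝ}
    {D₁ : Matrix (↥(pbox (fine Lc M')) × Fin (d + 1)) (Res (toSite r) Lc (fine Lc M')) ℝ}
    {D₂ : Matrix (↥(pbox (fine Lc M')) × Fin (d + 1)) (Res (toSite r') Lc M') ℝ}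
    {Dbar : Matrix (↥(pbox M') × Fin (d + 1)) (Res (toSite r') Lc M') ℝ}
    {P : Matrix (Res (toSite r') Lc M' ⊕ Res (toSite r) Lc (fine Lc M')) (↥(pbox (fine Lc M')) × Fin (d + 1)) ℝ}
    (hH₀ : H₀ = (perF (fine Lc M') (bhKStepAt d (toSite r) Lc j)).submatrix
        (fun b : ↥(pbox (fine Lc M')) × Fin (d + 1) => ((b.1, Sum.inl b.2) : Idx (fine Lc M') (Fib d)))
        (fun b : ↥(pbox (fine Lc M')) × Fin (d + 1) => ((b.1, Sum.inl b.2) : Idx (fine Lc M') (Fib d))))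
    (hQ₁₀ : Q₁₀ = (perF (fine Lc M') (bhKStepAt d (toSite r) Lc j)).submatrix
        (fun a : ↥(pbox M') × Fin (d + 1) => ((coarsePt M' Lc a.1, Sum.inr a.2) : Idx (fine Lc M') (Fib d)))
        (fun b : ↥(pbox (fine Lc M')) × Fin (d + 1) => ((b.1, Sum.inl b.2) : Idx (fine Lc M') (Fib d))))
    (hτ₁ : τ₁ = (combRowsT (toSite r) Lc (fine Lc M')).submatrix id
        (fun b : ↥(pbox (fine Lc M')) × Fin (d + 1) => ((b.1, Sum.inl b.2) : Idx (fine Lc M') (Fib d))))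
    (hτ₂ : τ₂ = (combRowsT (toSite r') Lc M').submatrix id (fun b : ↥(pbox M') × Fin (d + 1) => ((b.1, Sum.inl b.2) : Idx M' (Fib d))))
    (hD₁ : D₁ = (tgrad (fine Lc M')).submatrix (fun b : ↥(pbox (fine Lc M')) × Fin (d + 1) => ((b.1, Sum.inl b.2) : Idx (fine Lc M') (Fib d)))
        (Subtype.val : Res (toSite r) Lc (fine Lc M') → ↥(pbox (fine Lc M'))))
    (hD₂ : D₂ = (tgradBlock M' Lc).submatrix (fun b : ↥(pbox (fine Lc M')) × Fin (d + 1) => ((b.1, Sum.inl b.2) : Idx (fine Lc M') (Fib d)))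
        (Subtype.val : Res (toSite r') Lc M' → ↥(pbox M')))
    (hDbar : Dbar = Matrix.of fun (a : ↥(pbox M') × Fin (d + 1)) (t : Res (toSite r') Lc M') =>
        stepScale d Lc j * (((box (d + 1) Lc).card : ℝ) * tgrad M' (a.1, Sum.inl a.2) t.1))
    (hP : P = (combRowsT ((Lc : ℤ) • toSite r' + toSite r) (Lc * Lc) (fine Lc M')).submatrix
        (resBigEquiv Lc Lc (toSite r) (toSite r') M' (Nat.pos_of_ne_zero (NeZero.ne Lc)) (toSite_mem_range hr)
          (Nat.pos_of_ne_zero (NeZero.ne Lc)) (toSite_mem_range hr')).symm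
        (fun b : ↥(pbox (fine Lc M')) × Fin (d + 1) => ((b.1, Sum.inl b.2) : Idx (fine Lc M') (Fib d))))
    -- the displayed jets: form, averaging (both levels), block covariance, generators (fine and coarse), Ward witnesses
    (H₁ H₂ : Matrix (↥(pbox (fine Lc M')) × Fin (d + 1)) (↥(pbox (fine Lc M')) × Fin (d + 1)) ℝ)
    {Q₂₀ : Matrix κ (↥(pbox M') × Fin (d + 1)) ℝ}
    (hQ₂₀ : Q₂₀ = (perF M' (bhKStepAt d (toSite r') Lc (j + 1))).submatrix (fun a : κ => ((pμ' a, Sum.inr (mμ' a)) : Idx M' (Fib d)))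
        (fun b : ↥(pbox M') × Fin (d + 1) => ((b.1, Sum.inl b.2) : Idx M' (Fib d))))
    -- leaf-02's ORDER-1 ROWS ALONG A DIRECTION `h` AND THE GAUGE PARAMETER `λ` OF THE CHART TRANSPORT: the insertion-table families (fine, and coarse
    -- transported by `θ_j·Q₁₀`), the generator jet and the coarse jet by their defining equations (p314580, `PeriodisedCoarseWardContact`, `NestedStepLawTorusInstanceRows`)
    (h : ↥(pbox (fine Lc M')) × Fin (d + 1) → ℝ) (lam : ↥(pbox (fine Lc M')) → ℝ)
    (Q₁₁ : (↥(pbox (fine Lc M')) × Fin (d + 1) → ℝ) → Matrix (↥(pbox M') × Fin (d + 1)) (↥(pbox (fine Lc M')) × Fin (d + 1)) ℝ)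
    (hQ₁₁ : ∀ w, Q₁₁ w = ∑ b : ↥(pbox (fine Lc M')) × Fin (d + 1), w b •
        (perF (fine Lc M') (dper (fine Lc M') (vhSAt (toSite r) d Lc rfl b.2 (b.1 : Site (d + 1))))).submatrix
          (fun a : ↥(pbox M') × Fin (d + 1) => ((coarsePt M' Lc a.1, Sum.inr a.2) : Idx (fine Lc M') (Fib d)))
          (fun b : ↥(pbox (fine Lc M')) × Fin (d + 1) => ((b.1, Sum.inl b.2) : Idx (fine Lc M') (Fib d))))
    (Q₂₁ : (↥(pbox (fine Lc M')) × Fin (d + 1) → ℝ) → Matrix κ (↥(pbox M') × Fin (d + 1)) ℝ)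
    (hQ₂₁ : ∀ w, Q₂₁ w = ∑ b : ↥(pbox (fine Lc M')) × Fin (d + 1), w b •
        ∑ a' : ↥(pbox M') × Fin (d + 1), (stepScale d Lc (j + 1) / (stepScale d Lc j ^ 2 * ((box (d + 1) Lc).card : ℝ)) * Q₁₀ a' b) •
          (perF M' (dper M' (vhSAt (toSite r') d Lc rfl a'.2 (a'.1 : Site (d + 1))))).submatrix (fun a : κ => ((pμ' a, Sum.inr (mμ' a)) : Idx M' (Fib d)))
            (fun b : ↥(pbox M') × Fin (d + 1) => ((b.1, Sum.inl b.2) : Idx M' (Fib d))))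
    {W₁ : Matrix (↥(pbox (fine Lc M')) × Fin (d + 1)) (Res (toSite r') Lc M' ⊕ Res (toSite r) Lc (fine Lc M')) ℝ}
    (hW₁ : W₁ = ∑ b : ↥(pbox (fine Lc M')) × Fin (d + 1), h b •
        Matrix.of (fun (b' : ↥(pbox (fine Lc M')) × Fin (d + 1)) (e : Res (toSite r') Lc M' ⊕ Res (toSite r) Lc (fine Lc M')) =>
          if b' = b then
            -((((Lc : ℝ) ^ (d + 1) * stepScale d Lc j)⁻¹)
              * Sum.elim (fun t : Res (toSite r') Lc M' => tdelta M' (quo Lc ((b.1 : Site (d + 1)) + unitVec b.2)) t.1)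
                  (fun s : Res (toSite r) Lc (fine Lc M') => tdelta (fine Lc M') ((b.1 : Site (d + 1)) + unitVec b.2) s.1) e)
          else 0))
    {Db₁ : Matrix (↥(pbox M') × Fin (d + 1)) (Res (toSite r') Lc M') ℝ}
    (hDb₁ : Db₁ = ∑ b : ↥(pbox (fine Lc M')) × Fin (d + 1), h b •
        Matrix.of fun (a : ↥(pbox M') × Fin (d + 1)) (t : Res (toSite r') Lc M') =>
          -((((Lc : ℝ) ^ (d + 1) * stepScale d Lc j)⁻¹) * Q₁₀ a b * tdelta M' ((a.1 : Site (d + 1)) + unitVec a.2) t.1))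
    -- the NESTED chart's direction is average-coarse-comb-dead (the hypothesis of `torus_t1_of_average_dead`)
    (hdead : ∀ (a : ↥(pbox M') × Fin (d + 1)) (x : Res (toSite r') Lc M'),
      combBondT (toSite r') Lc M' x = ((a.1, Sum.inl a.2) : Idx M' (Fib d)) → ∑ b : ↥(pbox (fine Lc M')) × Fin (d + 1), Q₁₀ a b * h b = 0)
    -- the second-order data stay displayed
    (Q₁₂ : Matrix (↥(pbox M') × Fin (d + 1)) (↥(pbox (fine Lc M')) × Fin (d + 1)) ℝ) (Q₂₂ : Matrix κ (↥(pbox M') × Fin (d + 1)) ℝ)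
    (W₂ : Matrix (↥(pbox (fine Lc M')) × Fin (d + 1)) (Res (toSite r') Lc M' ⊕ Res (toSite r) Lc (fine Lc M')) ℝ)
    (Db₂ : Matrix (↥(pbox M') × Fin (d + 1)) (Res (toSite r') Lc M') ℝ)
    (Y₁ Y₂ Y'₁ Y'₂ : Matrix κ (Res (toSite r') Lc M' ⊕ Res (toSite r) Lc (fine Lc M')) ℝ)
    -- the chart transport (exponential currency): generators `X` (fields), `X̄` (composite multipliers); the one-shot chart's generator jets `W♯₁ W♯₂`;
    -- the parameter-transport jets `C₁ C₂`
    {X : Matrix (↥(pbox (fine Lc M')) × Fin (d + 1)) (↥(pbox (fine Lc M')) × Fin (d + 1)) ℝ} {Xbar : Matrix κ κ ℝ}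
    -- (T-β-1) at the torus: the transport generators ARE the diagonal gauge generators of the parameter `λ` (fields: `−c•E_λ`; composite multipliers: `c•R′_λ̄`)
    (hX : X = -((((Lc : ℝ) ^ (d + 1) * stepScale d Lc j)⁻¹) • Matrix.diagonal (fun b : ↥(pbox (fine Lc M')) × Fin (d + 1) => lam b.1)))
    (hXbar : Xbar = (((Lc : ℝ) ^ (d + 1) * stepScale d Lc j)⁻¹) •
        Matrix.diagonal (fun α : κ => ∑ t : ↥(pbox M'), tdelta M' ((pμ' α : Site (d + 1)) + toSite r') t
          * (∑ s : ↥(pbox (fine Lc M')), tdelta (fine Lc M') ((Lc : ℤ) • (t : Site (d + 1)) + toSite r) s * lam s)))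
    (W'₁ W'₂ : Matrix (↥(pbox (fine Lc M')) × Fin (d + 1)) (Res (toSite r') Lc M' ⊕ Res (toSite r) Lc (fine Lc M')) ℝ)
    (C₁ C₂ : Matrix (Res (toSite r') Lc M' ⊕ Res (toSite r) Lc (fine Lc M')) (Res (toSite r') Lc M' ⊕ Res (toSite r) Lc (fine Lc M')) ℝ)
    {𝔔₀ 𝔔₁ 𝔔₂ : Matrix κ (↥(pbox (fine Lc M')) × Fin (d + 1)) ℝ}
    (h𝔔₀ : Q₂₀ * Q₁₀ = 𝔔₀) (h𝔔₁ : Q₂₁ h * Q₁₀ + Q₂₀ * Q₁₁ h = 𝔔₁)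
    (h𝔔₂ : Q₂₂ * Q₁₀ + Q₂₁ h * Q₁₁ h + (Q₂₁ h * Q₁₁ h + Q₂₀ * Q₁₂) = 𝔔₂)
    -- (T-β-1) the ONE-SHOT literal's composite jets are the `X`-conjugated words of the nested-chart jets (`𝔎 = H`: δ-constrained), NAMED
    {H'₁ H'₂ : Matrix (↥(pbox (fine Lc M')) × Fin (d + 1)) (↥(pbox (fine Lc M')) × Fin (d + 1)) ℝ}
    {𝔔'₁ 𝔔'₂ : Matrix κ (↥(pbox (fine Lc M')) × Fin (d + 1)) ℝ}
    -- `q1` DISCHARGED (`PeriodisedCompositeIndexWard.torus_q1_letter`): the one-shot literal's first composite averaging jet IS the composite insertion jet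
    -- along the GAUGE-SHIFTED direction `h + Dλ`, NAMED
    (h𝔔'₁ : Q₂₁ (fun b => h b + ∑ s : ↥(pbox (fine Lc M')), tgrad (fine Lc M') (b.1, Sum.inl b.2) s * lam s) * Q₁₀
        + Q₂₀ * Q₁₁ (fun b => h b + ∑ s : ↥(pbox (fine Lc M')), tgrad (fine Lc M') (b.1, Sum.inl b.2) s * lam s) = 𝔔'₁)
    (k1 : Xᵀ * H₀ + H₁ + H₀ * X = H'₁)
    (k2 : (X * X)ᵀ * H₀ + (Xᵀ * H₁ + Xᵀ * H₀ * X) + ((Xᵀ * H₁ + Xᵀ * H₀ * X) + (H₂ + H₁ * X + (H₁ * X + H₀ * (X * X)))) = H'₂)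
    (q2 : Xbar * Xbar * 𝔔₀ + (Xbar * 𝔔₁ + Xbar * 𝔔₀ * X) + ((Xbar * 𝔔₁ + Xbar * 𝔔₀ * X) + (𝔔₂ + 𝔔₁ * X + (𝔔₁ * X + 𝔔₀ * (X * X)))) = 𝔔'₂)
    -- (T-β-4) intertwining of the transported nested-chart generators with the one-shot chart's generators, unimodular parameter transport
    (j1 : -X * fromCols D₂ D₁ + W₁ = W'₁ + fromCols D₂ D₁ * C₁)
    (j2 : X * X * fromCols D₂ D₁ + (2 : ℝ) • (-X * W₁) + W₂ = W'₂ + (2 : ℝ) • (W'₁ * C₁) + fromCols D₂ D₁ * C₂)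
    (uC : secondVar (1 : Matrix (Res (toSite r') Lc M' ⊕ Res (toSite r) Lc (fine Lc M')) (Res (toSite r') Lc M' ⊕ Res (toSite r) Lc (fine Lc M')) ℝ) C₁ C₂ = 0)
    -- dead rows: the big comb rows along the one-shot family; the small comb rows and the coarse comb rows of the average along the nested family
    (p1 : P * W'₁ = 0) (p2 : P * W'₂ = 0) (s1 : τ₁ * W₁ = 0) (s2 : τ₁ * W₂ = 0)
    (t2 : τ₂ * (Q₁₂ * fromCols D₂ D₁ + (2 : ℝ) • (Q₁₁ h * W₁) + Q₁₀ * W₂) = 0)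
    -- the second-order composite Ward TABLE IDENTITIES (δ-constrained: `𝔎 = H`; p308750's moving shapes, `W₀ := [D₂ | D₁]`) and their transposes
    -- orders 1 and 2 only (order 0 `a0 a0t` DISCHARGED with `Y₀ = Y'₀ = 0`: `PeriodisedWardOrderZero`)
    (a1 : H₁ * fromCols D₂ D₁ + H₀ * W₁ = 𝔔₀ᵀ * Y₁)
    (a2 : H₂ * fromCols D₂ D₁ + (2 : ℝ) • (H₁ * W₁) + H₀ * W₂ = (2 : ℝ) • (𝔔₁ᵀ * Y₁) + 𝔔₀ᵀ * Y₂)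
    (a1t : H₁ᵀ * fromCols D₂ D₁ + H₀ᵀ * W₁ = 𝔔₀ᵀ * Y'₁)
    (a2t : H₂ᵀ * fromCols D₂ D₁ + (2 : ℝ) • (H₁ᵀ * W₁) + H₀ᵀ * W₂ = (2 : ℝ) • (𝔔₁ᵀ * Y'₁) + 𝔔₀ᵀ * Y'₂)
    -- the insertion-table covariance TABLE IDENTITIES and the coarse covariance identities (order 0 discharged in p316503)
    -- order 2 only (order 1 `c1 d1` DISCHARGED: p314580, `PeriodisedCoarseWardContact`)
    (c2 : Q₁₂ * fromCols D₂ D₁ + (2 : ℝ) • (Q₁₁ h * W₁) + Q₁₀ * W₂ = fromCols Db₂ 0)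
    (d2 : Q₂₂ * Dbar + (2 : ℝ) • (Q₂₁ h * Db₁) + Q₂₀ * Db₂ = 0)
    -- block namings and the coarse non-degeneracy
    {Γ : Matrix (↥(pbox (fine Lc M')) × Fin (d + 1)) (↥(pbox (fine Lc M')) × Fin (d + 1)) ℝ}
    {I : Matrix (↥(pbox (fine Lc M')) × Fin (d + 1)) ((↥(pbox M') × Fin (d + 1)) ⊕ Res (toSite r) Lc (fine Lc M')) ℝ}
    {L : Matrix ((↥(pbox M') × Fin (d + 1)) ⊕ Res (toSite r) Lc (fine Lc M')) (↥(pbox (fine Lc M')) × Fin (d + 1)) ℝ}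
    {S : Matrix ((↥(pbox M') × Fin (d + 1)) ⊕ Res (toSite r) Lc (fine Lc M')) ((↥(pbox M') × Fin (d + 1)) ⊕ Res (toSite r) Lc (fine Lc M')) ℝ}
    {B : Matrix ((↥(pbox M') × Fin (d + 1)) ⊕ Res (toSite r) Lc (fine Lc M')) (↥(pbox (fine Lc M')) × Fin (d + 1)) ℝ}
    (hΓ : flucCov H₀ (fromRows Q₁₀ τ₁) = Γ) (hI : minOp H₀ (fromRows Q₁₀ τ₁) = I) (hL : minOpL H₀ (fromRows Q₁₀ τ₁) = L) (hS : effForm H₀ (fromRows Q₁₀ τ₁) = S)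
    (hB : fromRows (Q₁₁ h) (0 : Matrix (Res (toSite r) Lc (fine Lc M')) (↥(pbox (fine Lc M')) × Fin (d + 1)) ℝ) = B) :
    secondVar (kkt H₀ (fromRows 𝔔₀ P))
        (kkt H'₁ (fromRows 𝔔'₁ (0 : Matrix (Res (toSite r') Lc M' ⊕ Res (toSite r) Lc (fine Lc M')) (↥(pbox (fine Lc M')) × Fin (d + 1)) ℝ)))
        (kkt H'₂ (fromRows 𝔔'₂ (0 : Matrix (Res (toSite r') Lc M' ⊕ Res (toSite r) Lc (fine Lc M')) (↥(pbox (fine Lc M')) × Fin (d + 1)) ℝ)))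
      = secondVar (kkt H₀ (fromRows Q₁₀ τ₁)) (kkt H₁ B)
            (kkt H₂ (fromRows Q₁₂ (0 : Matrix (Res (toSite r) Lc (fine Lc M')) (↥(pbox (fine Lc M')) × Fin (d + 1)) ℝ)))
        + secondVar
            (kkt S.toBlocks₁₁ (fromRows Q₂₀ τ₂))
            (kkt ((L * H₁ - S * B) * I - L * Bᵀ * S).toBlocks₁₁ (fromRows (Q₂₁ h) (0 : Matrix (Res (toSite r') Lc M') (↥(pbox M') × Fin (d + 1)) ℝ)))
            (kkt (((-((L * H₁ - S * B) * Γ + L * Bᵀ * L) * H₁ + L * H₂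
                      - (((L * H₁ - S * B) * I - L * Bᵀ * S) * B
                          + S * fromRows Q₁₂ (0 : Matrix (Res (toSite r) Lc (fine Lc M')) (↥(pbox (fine Lc M')) × Fin (d + 1)) ℝ))) * I
                    + (L * H₁ - S * B) * (-((Γ * H₁ + I * B) * I - Γ * Bᵀ * S)))
                  - ((-((L * H₁ - S * B) * Γ + L * Bᵀ * L) * Bᵀ
                        + L * (fromRows Q₁₂ (0 : Matrix (Res (toSite r) Lc (fine Lc M')) (↥(pbox (fine Lc M')) × Fin (d + 1)) ℝ))ᵀ) * S
                      + L * Bᵀ * ((L * H₁ - S * B) * I - L * Bᵀ * S))).toBlocks₁₁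
              (fromRows Q₂₂ (0 : Matrix (Res (toSite r') Lc M') (↥(pbox M') × Fin (d + 1)) ℝ))) := by
  subst hX hXbar hW₁ hDb₁
  -- (T-β-1) `q1`: the conjugated first composite averaging word IS the composite insertion jet along `h + Dλ` (leaf-02 `PeriodisedCompositeIndexWard`)
  have q1 := torus_q1_letter M' hr hr' hM' j h lam pμ' mμ' hQ₁₀ hQ₂₀ Q₁₁ hQ₁₁ Q₂₁ hQ₂₁ h𝔔₀ h𝔔₁
  rw [h𝔔'₁] at q1
  exact secondVar_oneShot_nestedStepLaw_torus_transported M' hr hr' hM' j pμ' mμ' hfμ' hcoarse' hH₀ hQ₁₀ hτ₁ hτ₂ hD₁ hD₂ hDbar hP H₁ H₂ hQ₂₀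
    (Q₁₁ h) Q₁₂ (Q₂₁ h) Q₂₂ _ W₂ _ Db₂ 0 Y₁ Y₂ 0 Y'₁ Y'₂ _ _ W'₁ W'₂ C₁ C₂ h𝔔₀ h𝔔₁ h𝔔₂ k1 k2 q1 q2 j1 j2 uC p1 p2 s1 s2
    (torus_t1_of_average_dead M' hr j h hQ₁₀ hD₁ hD₂ hτ₂ (hQ₁₁ h) rfl hdead) t2
    (torus_a0_letter M' hr j hH₀ hD₁ hD₂ 𝔔₀) (by rw [Matrix.mul_zero, zero_add]; exact a1) (by rw [Matrix.mul_zero, zero_add]; exact a2)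
    (torus_a0t_letter M' hr j hH₀ hD₁ hD₂ 𝔔₀) (by rw [Matrix.mul_zero, zero_add]; exact a1t) (by rw [Matrix.mul_zero, zero_add]; exact a2t)
    (by rw [hQ₁₁ h]; exact torus_c1_vhSAt_weighted M' hr j h hQ₁₀ hD₁ hD₂) c2
    (by rw [hQ₂₁ h]; exact torus_d1_vhSAt_weighted M' hr' hM' j pμ' mμ' hQ₂₀ hDbar Q₁₀ h) d2 hΓ hI hL hS hB

end Summit.QuantumFields.BalabanUV.Beta.FP.NestedStepLawTorusTransportedRows

end
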